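import Mathlib
import Summits.NavierStokesRegularity.NavierStokesRegularity.Theorems.L3TimeExponentPincerRingPersistenceSlice
import Literature.Analysis.FluidPDE.AxisymNoSwirlTaoBounds
import HarnessLib.Audit
import HarnessLib

/-!
# L3TimeExponentPincer — ring persistence: the square-root scalar bootstrap and the a-priori
# slice bound `|∫ η⁻ 2(x_h·u)| ≤ ∫‖ω‖² + ∫‖u‖²`

Support kernel for the crux `L3CascadeJaw` (item stmt-NavierStokesRegularity-19499), two inputs of
the sup bootstrap of the PERSISTENCE LEMMA `LpPersistence 3 (1/2) 2` (nsreg-p2 ROUND-11/12):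
`scalar_bootstrap_sqrt` (`S ≤ Q + a√(√S)√S`, `a ≤ √(√Q)/2` ⇒ `S ≤ 2Q`) and
`abs_transport_le_apriori` (the transport pairing of `η⁻` is bounded by enstrophy plus energy,
uniformly along a Tao-class solution — the a-priori finiteness of `sup ∫ r²|η|`).
WHAT THIS IS NOT: not a statement about blow-up.
-/

namespace Summit.NavierStokesRegularity.NavierStokesRegularity.Theorems.L3TimeExponentPincerRingPersistenceApriori

open MeasureTheory Set Real Literature.Analysis.FluidPDE
open scoped ENNReal NNReal

/-- **Scalar bootstrap, square-root form**: `0 ≤ S ≤ Q + a √(√S) √S` with `Q > 0` and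
`a ≤ √(√Q)/2` imply `S ≤ 2Q`. -/
theorem scalar_bootstrap_sqrt {S Q a : ℝ} (hS : 0 ≤ S) (hQ : 0 < Q)
    (haQ : a ≤ Real.sqrt (Real.sqrt Q) / 2) (hle : S ≤ Q + a * (Real.sqrt (Real.sqrt S) * Real.sqrt S)) :
    S ≤ 2 * Q := by
  rcases le_or_gt S Q with h | h
  · linarith
  · have hQ4 : Real.sqrt (Real.sqrt Q) ≤ Real.sqrt (Real.sqrt S) :=
      Real.sqrt_le_sqrt (Real.sqrt_le_sqrt h.le)
    have hprod : Real.sqrt (Real.sqrt S) * (Real.sqrt (Real.sqrt S) * Real.sqrt S) = S := by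
      rw [← mul_assoc, Real.mul_self_sqrt (Real.sqrt_nonneg _), Real.mul_self_sqrt hS]
    have hnn : 0 ≤ Real.sqrt (Real.sqrt S) * Real.sqrt S := by positivity
    have key : a * (Real.sqrt (Real.sqrt S) * Real.sqrt S) ≤ S / 2 := by
      calc a * (Real.sqrt (Real.sqrt S) * Real.sqrt S)
          ≤ (Real.sqrt (Real.sqrt Q) / 2) * (Real.sqrt (Real.sqrt S) * Real.sqrt S) :=
            mul_le_mul_of_nonneg_right haQ hnn
        _ ≤ (Real.sqrt (Real.sqrt S) / 2) * (Real.sqrt (Real.sqrt S) * Real.sqrt S) := by gcongr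
        _ = S / 2 := by rw [div_mul_eq_mul_div, hprod]
    linarith


section Apriori

variable {T ν : ℝ} {u₀ : EuclideanSpace ℝ (Fin 3) → EuclideanSpace ℝ (Fin 3)}
  {u : ℝ → EuclideanSpace ℝ (Fin 3) → EuclideanSpace ℝ (Fin 3)}
  {p : ℝ → EuclideanSpace ℝ (Fin 3) → ℝ}

/-- **A priori slice bound** `|∫ (Ω(s))⁻ 2(x_h·u(s))| ≤ ∫‖ω(s)‖² + ∫‖u(s)‖²` (Cauchy–Schwarz
`2 r|Ω|‖u‖ ≤ (r|Ω|)² + ‖u‖²`, `r|Ω| = ‖ω‖`), uniformly bounded in Tao's class. -/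
theorem abs_transport_le_apriori (h : IsTaoSolutionOn T ν u₀ u p) (hT : 0 < T) (hν : 0 < ν)
    (h0 : IsAxisymmetric u₀) (h0' : HasNoSwirl u₀) {s : ℝ} (hs : s ∈ Icc 0 T) :
    |∫ x, (angVortQuot (u s) x)⁻ * (2 * (x 0 * u s x 0 + x 1 * u s x 1))| ≤
      (∫ x, ‖curl (u s) x‖ ^ 2) + ∫ x, ‖u s x‖ ^ 2 := by
  have hax : IsAxisymmetric (u s) := h.isAxisymmetric hν hT h0 s hs
  have hsw : HasNoSwirl (u s) := h.hasNoSwirl hν hT h0 h0' s hs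
  have hu := h.classical.contDiff_velocity hs
  have hu3 : ContDiff ℝ 3 (u s) := hu.of_le (by norm_cast)
  have hωeq : ∀ x, ‖curl (u s) x‖ = cylRadius x * |angVortQuot (u s) x| :=
    norm_curl_eq_cylRadius_mul_abs_angVortQuot hax hsw hu3
  obtain ⟨hω2, -⟩ := integrable_norm_curl_sq (hu.of_le (by norm_cast)) ((h.slice hs).2.2 1)
  have hu2 : Integrable fun x => ‖u s x‖ ^ 2 := h.integrable_norm_sq hs
  calc |∫ x, (angVortQuot (u s) x)⁻ * (2 * (x 0 * u s x 0 + x 1 * u s x 1))|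
      ≤ ∫ x, |(angVortQuot (u s) x)⁻ * (2 * (x 0 * u s x 0 + x 1 * u s x 1))| := by
        have := norm_integral_le_integral_norm (μ := (volume : Measure (EuclideanSpace ℝ (Fin 3))))
          (fun x => (angVortQuot (u s) x)⁻ * (2 * (x 0 * u s x 0 + x 1 * u s x 1)))
        simpa only [Real.norm_eq_abs] using this
    _ ≤ ∫ x, (‖curl (u s) x‖ ^ 2 + ‖u s x‖ ^ 2) := by
        refine integral_mono_of_nonneg (Filter.Eventually.of_forall fun x => abs_nonneg _)
          (hω2.add hu2) (Filter.Eventually.of_forall fun x => ?_)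
        show |(angVortQuot (u s) x)⁻ * (2 * (x 0 * u s x 0 + x 1 * u s x 1))| ≤
          ‖curl (u s) x‖ ^ 2 + ‖u s x‖ ^ 2
        rw [abs_mul, abs_of_nonneg (negPart_nonneg _), abs_mul, abs_two, hωeq x]
        have hh := abs_horizontal_inner_le x (u s x)
        have hn : (angVortQuot (u s) x)⁻ ≤ |angVortQuot (u s) x| :=
          le_trans (le_add_of_nonneg_left (posPart_nonneg _)) (posPart_add_negPart _).le
        have hr := cylRadius_nonneg x
        calc (angVortQuot (u s) x)⁻ * (2 * |x 0 * u s x 0 + x 1 * u s x 1|)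
            ≤ |angVortQuot (u s) x| * (2 * (cylRadius x * ‖u s x‖)) :=
              mul_le_mul hn (mul_le_mul_of_nonneg_left hh zero_le_two) (by positivity) (abs_nonneg _)
          _ = 2 * (cylRadius x * |angVortQuot (u s) x|) * ‖u s x‖ := by ring
          _ ≤ (cylRadius x * |angVortQuot (u s) x|) ^ 2 + ‖u s x‖ ^ 2 := two_mul_le_add_sq _ _
    _ = (∫ x, ‖curl (u s) x‖ ^ 2) + ∫ x, ‖u s x‖ ^ 2 := integral_add hω2 hu2

end Apriori

end Summit.NavierStokesRegularity.NavierStokesRegularity.Theorems.L3TimeExponentPincerRingPersistenceApriori
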